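import Mathlib

/-!
# Route «KPlusLogSqLaw», crux `WeakLifting` (stmt-ValiantsHypothesis-19561) — door (A′), pattern 𝒫: the FOLD CRITERION of the V-count
# (THEOREM 7⁺ of the cell note THEORY-NOTE-g16 v3 §6e; kernel core, g16)

HONEST FRAMING.  Helper lemmas (`--supports stmt-ValiantsHypothesis-19561 --as helper`), seat pub-symmetroid-conjb-2 (g16), cell `pub-symmetroid`,
2026-08-28.  One-variable calculus and two polynomial inequalities; nothing here is an upper bound on any root count and nothing bears on
`WeakLifting` / `TropicalB` in their windows, on Conjecture B (`KPlusLogSqLaw`), on `MatrixDescartes` or on VP ≠ VNP.  Context: the same day the cell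
REFUTED the half-turn law (A′) `HalfTurnStripRowTwo` in general (explicit m = 8 design with 8 zeros in `Re z > 0`; exact Routh certificate, cell deposit
HOME/pub-symmetroid-conjb-2/g16/negative/); the lemmas below are the positive half of that dichotomy.

CONTENT (paper: THEORY-NOTE-g16 §6b, §6e; companion of `KPlusLogSqLawTwoPointIdentity.lean`, p612583).  For a pattern-𝒫 prefix `X(−1)(+2)` the «V-count»
is `G(x) = x + a·x²·U(x)/(U(x) + V)` with `a > 0` the weight of `+2`, `V = a₁² > 0` and `U(x) = x(1 + a x)R(x)²` built from the P-block ratio `R`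
(`vcount_form` of the companion file).  `hasDerivAt_vcount`: if `U` is differentiable at `x` with `U x > 0` then
  `G′(x) = 1 + a x θ (2 + Δ (1 − θ))`,  `θ = U/(U+V)`,  `Δ = x U′/U`   — the EXACT FOLD CRITERION (a fold of the wall curve needs the bracket negative, i.e. `Δ < −2`).
With `Δ = 1 + s_c + 2 s_R` (`s_c = a x/(1 + a x)`, `s_R` the log-slope of `R`, `|s_R| <` block length) the bracket can only be negative for blocks of
length ≥ 2, and `fold_bracket_lower_bound` + `theta_quad_le` show that for `s_R > −2` (every block of length ≤ 2) the derivative stays `≥ 31/32`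
(`vcount_deriv_ge`): no fold, no descending strand, winding correction `W ≤ 0`, and (A′) for the words `X(−1)(+2)(−1)(+1)`, `|X| ≤ 2`.  For `|X| = 3`
the bound is void and folds occur — that is the (A′) counterexample.  [this seat; elementary]
-/

-- `Summit.ValiantsHypothesis.ValiantsHypothesis.…` repeats a component by the D-0017 layout (single-conjunct summit); the name is mandated.
set_option linter.dupNamespace false

namespace Summit.ValiantsHypothesis.ValiantsHypothesis.Theorems.KPlusLogSqLaw.FoldCriterion

/-! ## 1. The exact derivative of the V-count -/

/-- FOLD CRITERION (exact derivative).  For `G(y) = y + a y² U(y)/(U(y) + V)` with `U` differentiable at `x`, `U x > 0`, `V ≥ 0`: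
`G′(x) = 1 + a x θ (2 + Δ(1 − θ))` where `θ = U x/(U x + V)` and `Δ = x U′/U x` is the log-slope of `U`. -/
theorem hasDerivAt_vcount (a V x U' : ℝ) (U : ℝ → ℝ) (hU : HasDerivAt U U' x) (hUx : 0 < U x) (hV : 0 ≤ V) :
    HasDerivAt (fun y => y + a * y ^ 2 * U y / (U y + V))
      (1 + a * x * (U x / (U x + V)) * (2 + (x * U' / U x) * (1 - U x / (U x + V)))) x := by
  have hden : U x + V ≠ 0 := by positivity
  have hUne : U x ≠ 0 := hUx.ne'
  have h1 : HasDerivAt (fun y => a * y ^ 2) (a * (2 * x)) x := by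
    simpa using ((hasDerivAt_pow 2 x).const_mul a)
  have hnum : HasDerivAt (fun y => a * y ^ 2 * U y) (a * (2 * x) * U x + a * x ^ 2 * U') x := h1.mul hU
  have hden' : HasDerivAt (fun y => U y + V) U' x := by
    simpa using hU.add_const V
  have hfin : HasDerivAt (fun y => y + a * y ^ 2 * U y / (U y + V))
      (1 + ((a * (2 * x) * U x + a * x ^ 2 * U') * (U x + V) - a * x ^ 2 * U x * U') / (U x + V) ^ 2) x :=
    (hasDerivAt_id x).add (hnum.div hden' hden)
  convert hfin using 1
  field_simp
  ring

/-! ## 2. The two inequalities behind «|X| ≤ 2 ⇒ no fold» -/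

/-- The quadratic maximum: `4c·θ(1 − cθ) ≤ 1` (i.e. `θ (1 − c θ) ≤ 1/(4c)` for `c > 0`), cleared form, any real `c`. -/
theorem theta_quad_le (c θ : ℝ) : 4 * c * (θ * (1 - c * θ)) ≤ 1 := by
  nlinarith [sq_nonneg (2 * c * θ - 1)]

/-- `A θ (1 − (3 + 2A) θ) ≤ (1 + A)/32` for `A ≥ 0` (the worst case of the fold bracket for blocks of length ≤ 2, denominator `1 + A` cleared):
AM–GM in `θ` gives `≤ A/(4(3 + 2A))`, and `8A ≤ (1 + A)(3 + 2A)` because `2A² − 3A + 3 > 0`. -/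
theorem fold_sup_bound (A θ : ℝ) (hA : 0 ≤ A) : A * (θ * (1 - (3 + 2 * A) * θ)) ≤ (1 + A) / 32 := by
  have hc : 0 < 3 + 2 * A := by linarith
  have h1 : 4 * (3 + 2 * A) * (θ * (1 - (3 + 2 * A) * θ)) ≤ 1 := theta_quad_le _ _
  -- A * q ≤ A / (4(3+2A)) ≤ (1+A)/32
  have h2 : A * (θ * (1 - (3 + 2 * A) * θ)) * (4 * (3 + 2 * A)) ≤ A := by
    have := mul_le_mul_of_nonneg_left h1 hA
    nlinarith [this]
  have h3 : 8 * A ≤ (1 + A) * (3 + 2 * A) := by nlinarith [sq_nonneg (A - 1), hA]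
  nlinarith [h2, h3, hc]

/-- The fold bracket is bounded below on blocks of length ≤ 2.  With `s_c = A/(1+A)` and any log-slope `s > −2`, for `θ ∈ [0,1]` and `A ≥ 0`:
`A θ (2 + (1 + s_c + 2 s)(1 − θ)) ≥ −1/32`. -/
theorem fold_bracket_lower_bound (A θ s : ℝ) (hA : 0 ≤ A) (hθ0 : 0 ≤ θ) (hθ1 : θ ≤ 1) (hs : -2 < s) :
    -(1 / 32 : ℝ) ≤ A * θ * (2 + (1 + A / (1 + A) + 2 * s) * (1 - θ)) := by
  have h1A : 0 < 1 + A := by linarith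
  -- replace s by its worst case −2: the bracket is increasing in s since A θ (1 − θ) ≥ 0
  have hmono : A * θ * (2 + (1 + A / (1 + A) + 2 * (-2)) * (1 - θ))
      ≤ A * θ * (2 + (1 + A / (1 + A) + 2 * s) * (1 - θ)) := by
    have hw : 0 ≤ A * θ * (1 - θ) := by
      have : 0 ≤ 1 - θ := by linarith
      positivity
    nlinarith [hw, hs]
  refine le_trans ?_ hmono
  -- worst case: A θ (2 − (3 − s_c)(1 − θ)) = −A θ ((1 − s_c) − (3 − s_c) θ) = −A θ (1 − (3+2A) θ)/(1+A)
  have h1A' : (1 + A) ≠ 0 := h1A.ne'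
  have key : A * θ * (2 + (1 + A / (1 + A) + 2 * (-2)) * (1 - θ))
      = -(A * (θ * (1 - (3 + 2 * A) * θ)) / (1 + A)) := by
    field_simp
    ring
  rw [key, neg_le_neg_iff, div_le_iff₀ h1A]
  have := fold_sup_bound A θ hA
  linarith

/-- THEOREM 7⁺, quantitative core: under the hypotheses of `fold_bracket_lower_bound` the V-count derivative `1 + A θ (2 + Δ(1 − θ))` with
`Δ = 1 + s_c + 2 s`, `s > −2`, is at least `31/32` — in particular positive: the wall curve of a pattern-𝒫 word `X(−1)(+2)…` with `|X| ≤ 2` has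
no descending strand. -/
theorem vcount_deriv_ge (A θ s : ℝ) (hA : 0 ≤ A) (hθ0 : 0 ≤ θ) (hθ1 : θ ≤ 1) (hs : -2 < s) :
    (31 / 32 : ℝ) ≤ 1 + A * θ * (2 + (1 + A / (1 + A) + 2 * s) * (1 - θ)) := by
  have := fold_bracket_lower_bound A θ s hA hθ0 hθ1 hs
  linarith

/-- The natural `θ = U/(U+V)` lies in `[0,1]` for `U > 0`, `V ≥ 0` (bookkeeping for `vcount_deriv_ge`). -/
theorem theta_mem_unitInterval (U V : ℝ) (hU : 0 < U) (hV : 0 ≤ V) : 0 ≤ U / (U + V) ∧ U / (U + V) ≤ 1 := by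
  have hden : 0 < U + V := by linarith
  refine ⟨by positivity, ?_⟩
  rw [div_le_one hden]
  linarith

/-- LOG-SLOPE RECURSION of a P-block ratio (paper §6e SLOPE LEMMA, one step): if `R = 1 + c/R₀` with `c, R₀ > 0` and the log-slopes are `s_c = x c′/c`,
`s₀ = x R₀′/R₀`, then the log-slope of `R` is `(1 − 1/R)(s_c − s₀)`.  Typed as the derivative identity for `R(y) = 1 + c(y)/R₀(y)`. -/
theorem hasDerivAt_ratio_step (x c' R₀' : ℝ) (c R₀ : ℝ → ℝ) (hc : HasDerivAt c c' x) (hR : HasDerivAt R₀ R₀' x)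
    (hcx : 0 < c x) (hRx : 0 < R₀ x) :
    HasDerivAt (fun y => 1 + c y / R₀ y) ((c x / R₀ x) * (c' / c x - R₀' / R₀ x)) x := by
  have hRne : R₀ x ≠ 0 := hRx.ne'
  have hcne : c x ≠ 0 := hcx.ne'
  have hfin : HasDerivAt (fun y => 1 + c y / R₀ y) ((c' * R₀ x - c x * R₀') / R₀ x ^ 2) x :=
    (hc.div hR hRne).const_add 1
  have e : (c x / R₀ x) * (c' / c x - R₀' / R₀ x) = (c' * R₀ x - c x * R₀') / R₀ x ^ 2 := by
    field_simp
  rw [e]; exact hfin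

/-- ONE-STEP SLOPE BOUND: with `R = 1 + c/R₀ > 1`, the factor `1 − 1/R = (c/R₀)/R` lies in `(0,1)`, so `|s_R| < |s_c − s₀| ≤ 1 + |s₀|` when `|s_c| = 1`
(letters `±2` have `c = w x^{±1}`, log-slope `±1`); iterating from `s = 0` gives `|s_R| < k` for a `k`-letter block.  Typed: the contraction factor. -/
theorem ratio_step_factor_mem (c R₀ : ℝ) (hc : 0 < c) (hR : 0 < R₀) :
    0 < (c / R₀) / (1 + c / R₀) ∧ (c / R₀) / (1 + c / R₀) < 1 := by
  have hq : 0 < c / R₀ := div_pos hc hR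
  refine ⟨by positivity, ?_⟩
  rw [div_lt_one (by linarith)]
  linarith

/-- The iterated bound in clean form: if `|s₀| < k` and the new slope is `s = λ (ε − s₀)` with `0 < λ < 1`, `ε = ±1`, then `|s| < k + 1`. -/
theorem slope_iterate_bound (k s₀ lam ε : ℝ) (hk : |s₀| < k) (hl0 : 0 < lam) (hl1 : lam < 1) (hε : |ε| = 1) :
    |lam * (ε - s₀)| < k + 1 := by
  have hk0 : 0 ≤ k := le_trans (abs_nonneg _) hk.le
  rw [abs_mul, abs_of_pos hl0]
  have h1 : |ε - s₀| ≤ |ε| + |s₀| := abs_sub ε s₀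
  rw [hε] at h1
  have h2 : |ε - s₀| < k + 1 := by linarith
  calc lam * |ε - s₀| ≤ 1 * |ε - s₀| := by
        apply mul_le_mul_of_nonneg_right hl1.le (abs_nonneg _)
    _ = |ε - s₀| := one_mul _
    _ < k + 1 := h2

/-- THE k = 2 CASE USED BY THEOREM 7⁺: two iterations from slope `0` keep the log-slope of the block ratio in `(−2, 2)`. -/
theorem slope_two_letters (lam₁ lam₂ ε₁ ε₂ : ℝ) (h10 : 0 < lam₁) (h11 : lam₁ < 1) (h20 : 0 < lam₂) (h21 : lam₂ < 1)
    (hε₁ : |ε₁| = 1) (hε₂ : |ε₂| = 1) :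
    |lam₂ * (ε₂ - lam₁ * (ε₁ - 0))| < 2 := by
  have h1 : |lam₁ * (ε₁ - 0)| < 1 := by
    rw [sub_zero, abs_mul, abs_of_pos h10, hε₁, mul_one]
    exact h11
  have h2 := slope_iterate_bound 1 (lam₁ * (ε₁ - 0)) lam₂ ε₂ h1 h20 h21 hε₂
  norm_num at h2
  simpa using h2

end Summit.ValiantsHypothesis.ValiantsHypothesis.Theorems.KPlusLogSqLaw.FoldCriterion
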